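import Literature.NumberTheory.Automorphic.UnitaryTwoIwahoriEdgeCountFibrewise            -- ★ B-p04 (g34) p843052 (R5a): `iwahori_subgroupOf_le`, the type-(1) twin; brings ★ (R3b)(R3c), ★ p842457
import Literature.NumberTheory.Automorphic.SelfDualLatticeScalarReductionTransport        -- ★ B-p08 (g28) p842998 FILE A: `units_inv_mul_sub_smul_one_mul`, `glIntReduction_*`, `residue_mul_residue_eq_one`
import HarnessLib

/-!
# The Iwahori edge count of an elliptic `γ ∈ U(1,1)` whose characteristic polynomial has a DOUBLE root mod `𝓂`, fibrewise (the type-(2) twin of ★ (R5a))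

Topic `NumberTheory/Automorphic`; namespace `Literature.NumberTheory.Automorphic` (and `….UnitaryGroup` for §1).  THEOREMS ONLY (no definition, no instance, no
notation, no named fact, no `sorry`); kernel lane.  Cell `pub/hodgecm-mathlib` (D-0151), crux H413 = `stmt-HodgeConjecture-24833`, line «N6nsGerm», stub
`stub_N6nsR2EP : RankOneEulerPoincareNonsplit` ((R2) = [Kottwitz1988 §2 Thm. 2] on the tree of `U(1,1)`; EP pen B-p04 (g34), LEAD F0P3a-plan (g10) WORD T9-8 (C));
brick (R2-t2) «TYPE-(2) EDGE COUNT», FILE B1 (B-p08 (g28), census `B-provers/B-p08/g28/CENSUS-R2t2-E2-assembly.B-p08g28.md`), over ★ (R3b)(R3c)(R5a) of the EP pen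
and ★ FILE A.  HONEST LABEL: HC_CM is proved only modulo the cell's remaining named inputs (hLiu418, h413) until rung 0 closes; unconditional algebra, nothing printed asserted.

THE MATHEMATICS (Kottwitz 1988 §2; Serre, *Trees* II.1.1).  `F` a field with a `ValuativeRel`, `σ ∕ σO ∕ τ` an involution with its integral and residual avatars,
`ha₀ : IsUnit (σO a₀ − a₀)` (unramified), `U = U(σ, Φ₂)`, `K = U ∩ GL₂(𝒪)`, `I = U ∩ Iwahori`.  ★ (R5a) evaluates the edge count `#Fix_γ(U ⧸ I)` of an elliptic `γ` WITH AN
EIGENFRAME over `F` (type (1)).  A type-(2) elliptic `γ` (`χ_γ` rootless) has none; what it has is the SQUARE RELATION `(γ − a·1)² = e·1` with `a = tr γ∕2 ∈ 𝒪`,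
`e = (tr² − 4det)∕4`, `|e| < 1` (2×2 Cayley–Hamilton, ★ FILE A `sub_smul_one_mul_self_eq_smul_one`) and `|σ(a)a − 1| < 1` (§1, from the companion relations).  That is all the
star counts need: every local monodromy `k_x = (out x)⁻¹ γ (out x) ∈ K` satisfies the same relation (`conj_sub_smul_one_mul_self`), so `k̄_x` is the SCALAR `ā` (star value `s + 1`,
`s = #{τt = −t} = q`, ★ `natCard_fixedBy_unitaryTwo_star_of_scalar`) or a unitary TRANSVECTION `ā + n̄` with `τ(ā)ā = 1` (star value `1`: ★ FILE A
`glIntReduction_sub_smul_one_sq_eq_zero` ∕ `residue_mul_residue_eq_one` feed ★ (R3b) `natCard_isotropic_fixed_eq_one_of_sq_eq_zero` through ★ (R3c) `natCard_fixedBy_unitaryTwo_star_eq`):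
* §1 `UnitaryGroup.map_half_trace_mul_sub_one_eq` — `σ(t∕2)(t∕2) − 1 = −(σβ∕β)·(t² − 4d)∕4` from `d σβ = −β`, `β σt + σβ t = 0` (★ `companion_unitary_antidiag_relations`);
* §2 `natCard_fixedBy_unitaryTwo_star_of_sq_eq_smul_one` — the TYPE-(2) STAR VALUE `1`;
  **`natCard_fixedBy_iwahori_eq_add_mul_of_sq_eq_smul_one`** — `#Fix_γ(U ⧸ I) = #Fix_γ(U ⧸ K) + s · #{x ∈ Fix_γ(U ⧸ K) : k_x ≡ a·1 (mod 𝓂)}` (★ p842457 with the section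
  `Quotient.out`, bookkeeping verbatim from ★ (R5a), hence the same `maxHeartbeats 400000`);
  `natCard_subtype_valuation_eq_natCard_subtype_inv_smul` — the valuation form of «`k_x ≡ a·1 (mod 𝓂)`» (★ (R3c) currency) and the `ϖ⁻¹`-form (★ FILE A ∕ lattice currency)
  count the same vertices (both say `k̄_x = ā·1`).
The CM reading at an inert place (`#Fix = Σ_(k≤N) q^k`, `#{scalar} = Σ_(k<N) q^k`, `E₂ + 1 = 2Σ_(k≤N) q^k`) is FILE B2 `Rogawski1990/UnitaryTwoTypeTwoEdgeCount`.

## References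
* [Kottwitz1988] R. E. Kottwitz, *Tamagawa numbers*, Ann. of Math. 127 (1988), 629–646, §2 Theorem 2 (`O_γ(f_EP) = χ(X^γ)`; fixed edges over fixed vertices).
* [Serre1980Trees] J.-P. Serre, *Trees* (1980), Ch. I §6, Ch. II §1.1.
* [Rogawski1990] J. D. Rogawski, *Automorphic Representations of Unitary Groups in Three Variables* (1990), §3.6 p. 31, §12.6 p. 174.
* [Flicker1998UnitaryFL] Y. Z. Flicker, *Elementary proof of the fundamental lemma for a unitary group*, Canad. J. Math. 50 (1998), §6 p. 97.
* [IwahoriMatsumoto1965] N. Iwahori, H. Matsumoto, Publ. Math. IHÉS 25 (1965), §2 (Iwahori subgroup, reduction mod `𝔓`).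
-/

set_option autoImplicit false

noncomputable section

open Matrix ValuativeRel
open scoped ValuativeRel Matrix MatrixGroups

namespace Literature.NumberTheory.Automorphic.UnitaryGroup

/-! ## §1 The residual norm of the double eigenvalue (any field) -/

section Frame

variable {K : Type*} [Field K] (σ : K →+* K)

/-- **`σ(t∕2)·(t∕2) − 1 = −(σβ∕β)·(t² − 4d)∕4`** from the companion relations `d·σβ = −β`, `β·σt + σβ·t = 0` (★ `companion_unitary_antidiag_relations`), `β ≠ 0`, `2 ≠ 0`:
for a type-(2) element (`|t² − 4d| < 1`, `|σβ∕β| = 1`) the half-trace `c = t∕2` — the double residual eigenvalue of every local monodromy — has residual NORM ONE.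
[cite: Flicker1998UnitaryFL, §6 p. 97] [cite: Kottwitz1988, §2] -/
theorem map_half_trace_mul_sub_one_eq {t d β : K} (hβ : β ≠ 0) (h2 : (2 : K) ≠ 0) (hd : d * σ β = -β) (ht : β * σ t + σ β * t = 0) :
    σ (t * 2⁻¹) * (t * 2⁻¹) - 1 = -(σ β * β⁻¹) * ((t ^ 2 - 4 * d) * 4⁻¹) := by
  have hσβ : σ β ≠ 0 := (map_ne_zero σ).2 hβ
  have h4 : (4 : K) ≠ 0 := by
    have : (4 : K) = 2 * 2 := by norm_num
    rw [this]; exact mul_ne_zero h2 h2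
  have hσt : σ t = -(σ β * β⁻¹) * t := by
    field_simp
    linear_combination ht
  have hd' : d = -(β * (σ β)⁻¹) := by
    field_simp
    linear_combination hd
  rw [map_mul, map_inv₀, map_ofNat, hσt, hd']
  field_simp
  ring

end Frame

end Literature.NumberTheory.Automorphic.UnitaryGroup

/-! ## §2 The type-(2) star value and the fibrewise edge count (the twin of ★ (R5a) for a scalar-or-transvection element) -/

namespace Literature.NumberTheory.Automorphic

section GenericTypeTwo

variable {F : Type*} [Field F] [ValuativeRel F] (σ : F →+* F) (σO : 𝒪[F] →+* 𝒪[F])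
  (hσO' : ∀ x : 𝒪[F], ((σO x : 𝒪[F]) : F) = σ x) (hσσ : ∀ x, σO (σO x) = x) {a₀ : 𝒪[F]} (ha₀ : IsUnit (σO a₀ - a₀))
  (τ : 𝓀[F] →+* 𝓀[F]) (hτ : ∀ x : 𝒪[F], IsLocalRing.residue 𝒪[F] (σO x) = τ (IsLocalRing.residue 𝒪[F] x))

omit [ValuativeRel F] in
/-- `↑(y⁻¹ γ y) − a·1 = y⁻¹ (γ − a·1) y` as matrices (coercions `↥U → GL₂ → M₂` unfolded; ★ `units_inv_mul_sub_smul_one_mul`). [cite: Kottwitz1988, §2] -/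
theorem coe_conj_sub_smul_one {J : Matrix (Fin 2) (Fin 2) F} (γ y : ↥(unitaryGroupOfForm σ J)) (a : F) :
    (((y⁻¹ * γ * y : ↥(unitaryGroupOfForm σ J)) : GL (Fin 2) F) : Matrix (Fin 2) (Fin 2) F) - a • (1 : Matrix (Fin 2) (Fin 2) F) =
      ((((y : ↥(unitaryGroupOfForm σ J)) : GL (Fin 2) F)⁻¹ : GL (Fin 2) F) : Matrix (Fin 2) (Fin 2) F) *
        ((((γ : ↥(unitaryGroupOfForm σ J)) : GL (Fin 2) F) : Matrix (Fin 2) (Fin 2) F) - a • (1 : Matrix (Fin 2) (Fin 2) F)) *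
          (((y : ↥(unitaryGroupOfForm σ J)) : GL (Fin 2) F) : Matrix (Fin 2) (Fin 2) F) := by
  rw [units_inv_mul_sub_smul_one_mul, Subgroup.coe_mul, Subgroup.coe_mul, Subgroup.coe_inv, Units.val_mul, Units.val_mul]

omit [ValuativeRel F] in
/-- **Conjugation keeps the square relation**: `(γ − a·1)² = e·1` ⇒ `(y⁻¹γy − a·1)² = e·1` (`y⁻¹(γ − a·1)y = y⁻¹γy − a·1`, ★ `units_inv_mul_sub_smul_one_mul`).
[cite: Kottwitz1988, §2] -/
theorem conj_sub_smul_one_mul_self {J : Matrix (Fin 2) (Fin 2) F} (γ y : ↥(unitaryGroupOfForm σ J)) {a e : F}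
    (hγ : ((((γ : ↥(unitaryGroupOfForm σ J)) : GL (Fin 2) F) : Matrix (Fin 2) (Fin 2) F) - a • (1 : Matrix (Fin 2) (Fin 2) F)) *
        ((((γ : ↥(unitaryGroupOfForm σ J)) : GL (Fin 2) F) : Matrix (Fin 2) (Fin 2) F) - a • (1 : Matrix (Fin 2) (Fin 2) F)) = e • (1 : Matrix (Fin 2) (Fin 2) F)) :
    ((((y⁻¹ * γ * y : ↥(unitaryGroupOfForm σ J)) : GL (Fin 2) F) : Matrix (Fin 2) (Fin 2) F) - a • (1 : Matrix (Fin 2) (Fin 2) F)) *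
        ((((y⁻¹ * γ * y : ↥(unitaryGroupOfForm σ J)) : GL (Fin 2) F) : Matrix (Fin 2) (Fin 2) F) - a • (1 : Matrix (Fin 2) (Fin 2) F)) =
      e • (1 : Matrix (Fin 2) (Fin 2) F) := by
  have hcoe := coe_conj_sub_smul_one σ γ y a
  have hyy : (((y : ↥(unitaryGroupOfForm σ J)) : GL (Fin 2) F) : Matrix (Fin 2) (Fin 2) F) *
      ((((y : ↥(unitaryGroupOfForm σ J)) : GL (Fin 2) F)⁻¹ : GL (Fin 2) F) : Matrix (Fin 2) (Fin 2) F) = 1 := Units.mul_inv _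
  rw [hcoe]
  calc _ = ((((y : ↥(unitaryGroupOfForm σ J)) : GL (Fin 2) F)⁻¹ : GL (Fin 2) F) : Matrix (Fin 2) (Fin 2) F) *
        (((((γ : ↥(unitaryGroupOfForm σ J)) : GL (Fin 2) F) : Matrix (Fin 2) (Fin 2) F) - a • (1 : Matrix (Fin 2) (Fin 2) F)) *
          ((((y : ↥(unitaryGroupOfForm σ J)) : GL (Fin 2) F) : Matrix (Fin 2) (Fin 2) F) *
            ((((y : ↥(unitaryGroupOfForm σ J)) : GL (Fin 2) F)⁻¹ : GL (Fin 2) F) : Matrix (Fin 2) (Fin 2) F)) *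
          ((((γ : ↥(unitaryGroupOfForm σ J)) : GL (Fin 2) F) : Matrix (Fin 2) (Fin 2) F) - a • (1 : Matrix (Fin 2) (Fin 2) F))) *
        (((y : ↥(unitaryGroupOfForm σ J)) : GL (Fin 2) F) : Matrix (Fin 2) (Fin 2) F) := by simp only [Matrix.mul_assoc]
    _ = _ := by rw [hyy, Matrix.mul_one, hγ, units_inv_mul_smul_one_mul]

include hσO' hσσ ha₀ hτ in
/-- **THE TYPE-(2) STAR VALUE — SCALAR-OR-TRANSVECTION, NON-SCALAR ⇒ ONE FIXED POINT ON THE STAR.**  For `k ∈ K = U(σ,Φ₂) ∩ GL₂(𝒪)` with `(k − a·1)² = e·1`, `a, e ∈ 𝒪`,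
`|e| < 1`, `|σ(a)·a − 1| < 1` and `k ≢ a·1 (mod 𝓂)`: the reduction `k̄` is a unitary TRANSVECTION `ā + n̄` (`n̄ ≠ 0 = n̄²`, ★ `glIntReduction_sub_smul_one_sq_eq_zero`) with
`τ(ā)ā = 1` (★ `residue_mul_residue_eq_one`), so exactly one isotropic point of `ℙ(𝓀²)` is `k̄`-fixed (★ (R3b) `natCard_isotropic_fixed_eq_one_of_sq_eq_zero`, ★ (R3c)
`natCard_fixedBy_unitaryTwo_star_eq`).  This is the type-(2) companion of ★ `natCard_fixedBy_unitaryTwo_star_of_valuation_sub_lt_one` (which needs an eigenframe over `F`).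
[cite: Kottwitz1988, §2] [cite: Serre1980Trees, Ch. II §1.1] -/
theorem natCard_fixedBy_unitaryTwo_star_of_sq_eq_smul_one [Finite 𝓀[F]] {J : Matrix (Fin 2) (Fin 2) F} (hJ : J = !![0, 1; 1, 0])
    (k : ↥((glInt 2 F).subgroupOf (unitaryGroupOfForm σ J))) {a e : F} (haO : a ∈ 𝒪[F]) (heO : e ∈ 𝒪[F]) (he : valuation F e < 1)
    (hk : ((((k : ↥(unitaryGroupOfForm σ J)) : GL (Fin 2) F) : Matrix (Fin 2) (Fin 2) F) - a • (1 : Matrix (Fin 2) (Fin 2) F)) *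
        ((((k : ↥(unitaryGroupOfForm σ J)) : GL (Fin 2) F) : Matrix (Fin 2) (Fin 2) F) - a • (1 : Matrix (Fin 2) (Fin 2) F)) = e • (1 : Matrix (Fin 2) (Fin 2) F))
    (hns : ¬ ∀ i j, valuation F ((((k : ↥(unitaryGroupOfForm σ J)) : GL (Fin 2) F) : Matrix (Fin 2) (Fin 2) F) i j -
      (a • (1 : Matrix (Fin 2) (Fin 2) F)) i j) < 1)
    (ha : valuation F (σ a * a - 1) < 1) :
    Nat.card (@MulAction.fixedBy _ (↥((glInt 2 F).subgroupOf (unitaryGroupOfForm σ J)) ⧸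
        ((iwahoriGL 2 F).subgroupOf (unitaryGroupOfForm σ J)).subgroupOf ((glInt 2 F).subgroupOf (unitaryGroupOfForm σ J))) _
        (MulAction.quotient _ _) k) = 1 := by
  rw [natCard_fixedBy_unitaryTwo_star_eq σ σO hσO' hσσ ha₀ τ hτ hJ k]
  have hM := transpose_map_glIntReduction_mul_antidiagTwo_mul σ σO hσO' τ hτ hJ k
  have hsq := glIntReduction_sub_smul_one_sq_eq_zero (⟨((k : ↥(unitaryGroupOfForm σ J)) : GL (Fin 2) F), k.2⟩ : ↥(glInt 2 F)) ⟨a, haO⟩ ⟨e, heO⟩ he hk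
  have hl : τ (IsLocalRing.residue 𝒪[F] ⟨a, haO⟩) * IsLocalRing.residue 𝒪[F] ⟨a, haO⟩ = 1 := by
    rw [← hτ]
    refine residue_mul_residue_eq_one (σO ⟨a, haO⟩) ⟨a, haO⟩ ?_
    rw [hσO']
    exact ha
  exact natCard_isotropic_fixed_eq_one_of_sq_eq_zero τ _ hM hsq (fun h => hns ((coe_glIntReduction_eq_smul_one_iff σ k ⟨a, haO⟩).1 h)) hl

include hσO' hσσ ha₀ hτ in
set_option maxHeartbeats 400000 in
/-- **THE TYPE-(2) FIBREWISE EDGE COUNT: `E(γ) = V(γ) + s · #{scalar-reduction vertices}`** (`s = #{t ∈ 𝓀 : τ t = −t}`): for `γ ∈ U(σ, Φ₂)` with `(γ − a·1)² = e·1`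
(`a, e ∈ 𝒪`, `|e| < 1`, `|σ(a)a − 1| < 1` — every elliptic element whose characteristic polynomial has a DOUBLE root modulo `𝓂`, e.g. the rootless type (2):
`a = tr γ∕2`, `e = (tr² − 4det)∕4`) and finitely many `γ`-fixed vertices, the `γ`-fixed edges number `#Fix_γ(U ⧸ K) + s · #{x ∈ Fix_γ(U ⧸ K) : (out x)⁻¹ γ (out x) ≡ a·1 (mod 𝓂)}`:
over each fixed vertex the monodromy `k_x = (out x)⁻¹ γ (out x)` satisfies the same square relation (`conj_sub_smul_one_mul_self`), so its star count is `s + 1` (scalar, ★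
`natCard_fixedBy_unitaryTwo_star_of_scalar`) or `1` (`natCard_fixedBy_unitaryTwo_star_of_sq_eq_smul_one`); sum by ★ `natCard_fixedBy_quotient_eq_sum_of_le` with the section
`Quotient.out`.  Twin of ★ (R5a) `natCard_fixedBy_iwahori_eq_add_mul_of_valuation_sub_lt_one`, same bookkeeping (hence the same `maxHeartbeats 400000`: the `Finset.sum_ite`
step over `↥(fixedBy (↥U ⧸ K_U) γ)` costs ≈ 250k). [cite: Kottwitz1988, §2] [cite: Rogawski1990, §12.6 p. 174] -/
theorem natCard_fixedBy_iwahori_eq_add_mul_of_sq_eq_smul_one [Finite 𝓀[F]] {J : Matrix (Fin 2) (Fin 2) F} (hJ : J = !![0, 1; 1, 0])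
    (γ : ↥(unitaryGroupOfForm σ J)) {a e : F} (haO : a ∈ 𝒪[F]) (heO : e ∈ 𝒪[F]) (he : valuation F e < 1)
    (hγ : ((((γ : ↥(unitaryGroupOfForm σ J)) : GL (Fin 2) F) : Matrix (Fin 2) (Fin 2) F) - a • (1 : Matrix (Fin 2) (Fin 2) F)) *
        ((((γ : ↥(unitaryGroupOfForm σ J)) : GL (Fin 2) F) : Matrix (Fin 2) (Fin 2) F) - a • (1 : Matrix (Fin 2) (Fin 2) F)) = e • (1 : Matrix (Fin 2) (Fin 2) F))
    (ha : valuation F (σ a * a - 1) < 1)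
    [Finite (MulAction.fixedBy (↥(unitaryGroupOfForm σ J) ⧸ (glInt 2 F).subgroupOf (unitaryGroupOfForm σ J)) γ)] :
    Nat.card (MulAction.fixedBy (↥(unitaryGroupOfForm σ J) ⧸ (iwahoriGL 2 F).subgroupOf (unitaryGroupOfForm σ J)) γ) =
      Nat.card (MulAction.fixedBy (↥(unitaryGroupOfForm σ J) ⧸ (glInt 2 F).subgroupOf (unitaryGroupOfForm σ J)) γ) +
        Nat.card {t : 𝓀[F] // τ t = -t} *
          Nat.card {x : MulAction.fixedBy (↥(unitaryGroupOfForm σ J) ⧸ (glInt 2 F).subgroupOf (unitaryGroupOfForm σ J)) γ //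
            ∀ i j, valuation F (((((x.1.out)⁻¹ * γ * x.1.out : ↥(unitaryGroupOfForm σ J)) : GL (Fin 2) F) : Matrix (Fin 2) (Fin 2) F) i j -
              (a • (1 : Matrix (Fin 2) (Fin 2) F)) i j) < 1} := by
  classical
  letI instK : MulAction (↥((glInt 2 F).subgroupOf (unitaryGroupOfForm σ J))) (↥((glInt 2 F).subgroupOf (unitaryGroupOfForm σ J)) ⧸
      ((iwahoriGL 2 F).subgroupOf (unitaryGroupOfForm σ J)).subgroupOf ((glInt 2 F).subgroupOf (unitaryGroupOfForm σ J))) :=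
    MulAction.quotient _ _
  letI : Fintype (MulAction.fixedBy (↥(unitaryGroupOfForm σ J) ⧸ (glInt 2 F).subgroupOf (unitaryGroupOfForm σ J)) γ) := Fintype.ofFinite _
  haveI hfinstar : Finite (↥((glInt 2 F).subgroupOf (unitaryGroupOfForm σ J)) ⧸
      ((iwahoriGL 2 F).subgroupOf (unitaryGroupOfForm σ J)).subgroupOf ((glInt 2 F).subgroupOf (unitaryGroupOfForm σ J))) := by
    apply Nat.finite_of_card_ne_zero
    rw [natCard_unitaryTwo_star σ σO hσO' hσσ ha₀ τ hτ hJ]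
    exact Nat.succ_ne_zero _
  set r : ↥(unitaryGroupOfForm σ J) ⧸ (glInt 2 F).subgroupOf (unitaryGroupOfForm σ J) → ↥(unitaryGroupOfForm σ J) := Quotient.out with hr'
  have hr : Function.RightInverse r QuotientGroup.mk := fun x => Quotient.out_eq x
  haveI : ∀ x : MulAction.fixedBy (↥(unitaryGroupOfForm σ J) ⧸ (glInt 2 F).subgroupOf (unitaryGroupOfForm σ J)) γ,
      Finite (MulAction.fixedBy (↥((glInt 2 F).subgroupOf (unitaryGroupOfForm σ J)) ⧸
        ((iwahoriGL 2 F).subgroupOf (unitaryGroupOfForm σ J)).subgroupOf ((glInt 2 F).subgroupOf (unitaryGroupOfForm σ J)))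
        (⟨(r x.1)⁻¹ * γ * r x.1, inv_mul_mul_mem_of_smul_eq r hr γ x.2⟩ : ↥((glInt 2 F).subgroupOf (unitaryGroupOfForm σ J)))) :=
    fun x => Subtype.finite
  rw [natCard_fixedBy_quotient_eq_sum_of_le (iwahori_subgroupOf_le σ J) r hr γ]
  -- the star count over each fixed vertex
  have hterm : ∀ x : MulAction.fixedBy (↥(unitaryGroupOfForm σ J) ⧸ (glInt 2 F).subgroupOf (unitaryGroupOfForm σ J)) γ,
      Nat.card (MulAction.fixedBy (↥((glInt 2 F).subgroupOf (unitaryGroupOfForm σ J)) ⧸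
        ((iwahoriGL 2 F).subgroupOf (unitaryGroupOfForm σ J)).subgroupOf ((glInt 2 F).subgroupOf (unitaryGroupOfForm σ J)))
        (⟨(r x.1)⁻¹ * γ * r x.1, inv_mul_mul_mem_of_smul_eq r hr γ x.2⟩ : ↥((glInt 2 F).subgroupOf (unitaryGroupOfForm σ J)))) =
      if ∀ i j, valuation F (((((x.1.out)⁻¹ * γ * x.1.out : ↥(unitaryGroupOfForm σ J)) : GL (Fin 2) F) : Matrix (Fin 2) (Fin 2) F) i j -
          (a • (1 : Matrix (Fin 2) (Fin 2) F)) i j) < 1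
        then Nat.card {t : 𝓀[F] // τ t = -t} + 1 else 1 := by
    intro x
    split_ifs with h
    · exact natCard_fixedBy_unitaryTwo_star_of_scalar σ σO hσO' hσσ ha₀ τ hτ hJ _ (a := ⟨a, haO⟩) h
    · exact natCard_fixedBy_unitaryTwo_star_of_sq_eq_smul_one σ σO hσO' hσσ ha₀ τ hτ hJ _ haO heO he (conj_sub_smul_one_mul_self σ γ (r x.1) hγ) h ha
  simp_rw [hterm]
  rw [Finset.sum_ite, Finset.sum_const, Finset.sum_const, smul_eq_mul, smul_eq_mul, mul_one]
  have hV : Nat.card (MulAction.fixedBy (↥(unitaryGroupOfForm σ J) ⧸ (glInt 2 F).subgroupOf (unitaryGroupOfForm σ J)) γ) =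
      (Finset.univ : Finset (MulAction.fixedBy (↥(unitaryGroupOfForm σ J) ⧸ (glInt 2 F).subgroupOf (unitaryGroupOfForm σ J)) γ)).card := by
    rw [Nat.card_eq_fintype_card, Finset.card_univ]
  have hA : Nat.card {x : MulAction.fixedBy (↥(unitaryGroupOfForm σ J) ⧸ (glInt 2 F).subgroupOf (unitaryGroupOfForm σ J)) γ //
      ∀ i j, valuation F (((((x.1.out)⁻¹ * γ * x.1.out : ↥(unitaryGroupOfForm σ J)) : GL (Fin 2) F) : Matrix (Fin 2) (Fin 2) F) i j -
        (a • (1 : Matrix (Fin 2) (Fin 2) F)) i j) < 1} =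
      ((Finset.univ : Finset (MulAction.fixedBy (↥(unitaryGroupOfForm σ J) ⧸ (glInt 2 F).subgroupOf (unitaryGroupOfForm σ J)) γ)).filter fun x =>
        ∀ i j, valuation F (((((x.1.out)⁻¹ * γ * x.1.out : ↥(unitaryGroupOfForm σ J)) : GL (Fin 2) F) : Matrix (Fin 2) (Fin 2) F) i j -
          (a • (1 : Matrix (Fin 2) (Fin 2) F)) i j) < 1).card := by
    rw [Nat.card_eq_fintype_card, Fintype.card_subtype]
  rw [hV, hA, ← Finset.card_filter_add_card_filter_not
    (s := (Finset.univ : Finset (MulAction.fixedBy (↥(unitaryGroupOfForm σ J) ⧸ (glInt 2 F).subgroupOf (unitaryGroupOfForm σ J)) γ)))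
    (fun x => ∀ i j, valuation F (((((x.1.out)⁻¹ * γ * x.1.out : ↥(unitaryGroupOfForm σ J)) : GL (Fin 2) F) : Matrix (Fin 2) (Fin 2) F) i j -
      (a • (1 : Matrix (Fin 2) (Fin 2) F)) i j) < 1)]
  ring

/-- **THE TWO SCALAR-REDUCTION PREDICATES AGREE**: for a `γ`-fixed vertex `x`, «`(out x)⁻¹ γ (out x) ≡ a·1 (mod 𝓂)` entrywise by valuation» (★ (R3c)∕(R5a) currency) and
«`ϖ⁻¹·(out x)⁻¹(γ − a·1)(out x)` integral» (★ FILE A ∕ the lattice currency) both say `k̄_x = ā·1` (★ `coe_glIntReduction_eq_smul_one_iff`, ★ `glIntReduction_eq_smul_one_iff`),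
so the two refined fixed-vertex counts coincide. [cite: Kottwitz1988, §2] [cite: IwahoriMatsumoto1965, §2] -/
theorem natCard_subtype_valuation_eq_natCard_subtype_inv_smul {ϖ : F} (hϖ : IsUniformizingElement ϖ) {J : Matrix (Fin 2) (Fin 2) F}
    (γ : ↥(unitaryGroupOfForm σ J)) {a : F} (haO : a ∈ 𝒪[F]) :
    Nat.card {x : MulAction.fixedBy (↥(unitaryGroupOfForm σ J) ⧸ (glInt 2 F).subgroupOf (unitaryGroupOfForm σ J)) γ //
        ∀ i j, valuation F (((((x.1.out)⁻¹ * γ * x.1.out : ↥(unitaryGroupOfForm σ J)) : GL (Fin 2) F) : Matrix (Fin 2) (Fin 2) F) i j -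
          (a • (1 : Matrix (Fin 2) (Fin 2) F)) i j) < 1} =
      Nat.card {x : MulAction.fixedBy (↥(unitaryGroupOfForm σ J) ⧸ (glInt 2 F).subgroupOf (unitaryGroupOfForm σ J)) γ //
        ∀ i j, (ϖ⁻¹ • (((((x.1.out : ↥(unitaryGroupOfForm σ J)) : GL (Fin 2) F)⁻¹ : GL (Fin 2) F) : Matrix (Fin 2) (Fin 2) F) *
          ((((γ : ↥(unitaryGroupOfForm σ J)) : GL (Fin 2) F) : Matrix (Fin 2) (Fin 2) F) - a • (1 : Matrix (Fin 2) (Fin 2) F)) *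
          (((x.1.out : ↥(unitaryGroupOfForm σ J)) : GL (Fin 2) F) : Matrix (Fin 2) (Fin 2) F))) i j ∈ 𝒪[F]} := by
  have hr : Function.RightInverse
      (Quotient.out : ↥(unitaryGroupOfForm σ J) ⧸ (glInt 2 F).subgroupOf (unitaryGroupOfForm σ J) → ↥(unitaryGroupOfForm σ J)) QuotientGroup.mk :=
    fun x => Quotient.out_eq x
  refine Nat.card_congr (Equiv.subtypeEquivRight fun x => ?_)
  have hmem : (x.1.out)⁻¹ * γ * x.1.out ∈ (glInt 2 F).subgroupOf (unitaryGroupOfForm σ J) := inv_mul_mul_mem_of_smul_eq Quotient.out hr γ x.2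
  rw [← coe_glIntReduction_eq_smul_one_iff σ ⟨_, hmem⟩ ⟨a, haO⟩,
    glIntReduction_eq_smul_one_iff hϖ (⟨(((x.1.out)⁻¹ * γ * x.1.out : ↥(unitaryGroupOfForm σ J)) : GL (Fin 2) F), hmem⟩ : ↥(glInt 2 F)) ⟨a, haO⟩]
  show (∀ i j, (ϖ⁻¹ • ((((((x.1.out)⁻¹ * γ * x.1.out : ↥(unitaryGroupOfForm σ J))) : GL (Fin 2) F) : Matrix (Fin 2) (Fin 2) F) -
      a • (1 : Matrix (Fin 2) (Fin 2) F))) i j ∈ 𝒪[F]) ↔ _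
  rw [coe_conj_sub_smul_one σ γ x.1.out a]

end GenericTypeTwo

end Literature.NumberTheory.Automorphic

end
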